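import Summits.SmoothPoincare4.SmoothPoincare4.Theorems.CongruenceShadowsShadowApproximationStubLayerStepOneZeroConj
import Summits.SmoothPoincare4.SmoothPoincare4.Theorems.CongruenceShadowsShadowApproximationStubLayerStepOneZeroSeeds
import Summits.SmoothPoincare4.SmoothPoincare4.Theorems.CongruenceShadowsShadowApproximationStubLayerStepZeroRealiser
import Summits.SmoothPoincare4.SmoothPoincare4.Theorems.CongruenceShadowsShadowApproximationStubGoeritzRealisationPos
import Mathlib.LinearAlgebra.Matrix.ToLin
import Mathlib.LinearAlgebra.BilinearForm.Hom
import HarnessLib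

/-!
# Helper for stub `stub_layerStepOneZero` (line `nilpotent-genus-class`, crux
`CongruenceShadows.ShadowApproximation`, item stmt-SmoothPoincare4-14595):
# Goeritz realisers from integer matrices, and the conjugated seed realisers with their readings

`S = SurfaceGroup (3+3m)`, `N i = s4Kernels.stabilizeIter m i`, `H₁ = ℤ^{Fin (3+3m) × Bool}` (`ab = SurfaceGroup.abelianize`),
`γₖ₊₁ = (⊤).lowerCentralSeries k`.

* §1 `exists_linearEquiv_of_matrix`, `symplForm_of_matrix`, `mulVec_coord_eq_zero` — an integer matrix `M` with
  two-sided inverse `M'` is a linear automorphism `F` of `H₁`; it is an `ε`-isometry of the intersection form as soon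
  as its columns are (a finite check), and it preserves a coordinate Lagrangian as soon as the relevant block of entries
  vanishes (a finite check).
* §2 `exists_goeritz_of_matrix` — hence (the landed coordinate-pair Goeritz realisation `exists_goeritz_realises`,
  GS₀) such an `M` stabilising `Λ₀`, `Λ₁` is induced by a GOERITZ ELEMENT `x ∈ Stab N₀ ∩ Stab N₁`, with
  `ab (x ℓ) = M e_ℓ`, `ab (x⁻¹ ℓ) = M' e_ℓ` on the letters — all hypotheses decidable on concrete matrices.
* §3 `exists_conj_realiser` (genus `6 = 3 + 3·1`) — for such `x` and the seed `β = bp_{k,k+1}` (landed `exists_bp_handle`),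
  `y = x β x⁻¹ ∈ Stab N₀ ∩ Stab N₁` is IA and its corrections at the cut letters of the slot-`2` pattern `ct` read,
  through the erasing projection `π`, as the pair product of the CLOSED-FORM alternating reading
  `RD(M, M', k)` (conjugation formula `johnson_conj_seed` + `reading_of_table`, both landed).
No definitions.
-/

set_option linter.dupNamespace false

noncomputable section

open Subgroup Literature.Topology.FourManifolds Literature.Algebra.Lie Multiplicative
open Summit.SmoothPoincare4.SmoothPoincare4.Theorems.NilpotentShadowsStandard.SaturatedTorsorDescent
open scoped commutatorElement

namespace Summit.SmoothPoincare4.SmoothPoincare4.Theorems.ShadowApproximation.NilpotentGenusClass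

/-! ## §1 Linear automorphisms of `H₁` from integer matrices -/

section Matrices

variable {ι : Type*} [Fintype ι] [DecidableEq ι]

/-- An integer matrix with a two-sided inverse is a linear automorphism of `ℤ^ι`. [folklore] -/
theorem exists_linearEquiv_of_matrix (M M' : Matrix ι ι ℤ) (h1 : M * M' = 1) (h2 : M' * M = 1) :
    ∃ F : (ι → ℤ) ≃ₗ[ℤ] (ι → ℤ), (∀ v, F v = M.mulVec v) ∧ ∀ v, F.symm v = M'.mulVec v := by
  refine ⟨LinearEquiv.ofLinear (Matrix.toLin' M) (Matrix.toLin' M') ?_ ?_, fun v => ?_, fun v => ?_⟩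
  · rw [← Matrix.toLin'_mul, h1, Matrix.toLin'_one]
  · rw [← Matrix.toLin'_mul, h2, Matrix.toLin'_one]
  · rw [LinearEquiv.ofLinear_apply, Matrix.toLin'_apply]
  · rw [LinearEquiv.ofLinear_symm_apply, Matrix.toLin'_apply]

/-- The columns of `M` are the images of the coordinate vectors. [folklore] -/
theorem mulVec_single_one_eq_col (M : Matrix ι ι ℤ) (x : ι) : M.mulVec (Pi.single x 1) = fun k => M k x := by
  rw [Matrix.mulVec_single_one]
  rfl

variable {κ : Type*} [Fintype κ] [DecidableEq κ]

/-- **Isometry from the columns**: if the columns of `M` pair as `ε` times the coordinate vectors do, the linear map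
`v ↦ M v` is an `ε`-isometry of the intersection form. [folklore] -/
theorem symplForm_of_matrix (F : (κ × Bool → ℤ) ≃ₗ[ℤ] (κ × Bool → ℤ)) (M : Matrix (κ × Bool) (κ × Bool) ℤ)
    (hF : ∀ v, F v = M.mulVec v) (ε : ℤ)
    (hS : ∀ x y : κ × Bool, symplForm (fun k => M k x) (fun k => M k y) =
      ε * symplForm (Pi.single x (1 : ℤ) : κ × Bool → ℤ) (Pi.single y (1 : ℤ))) :
    ∀ u v : κ × Bool → ℤ, symplForm (F u) (F v) = ε * symplForm u v := by
  set B₁ : LinearMap.BilinForm ℤ (κ × Bool → ℤ) := (symplForm).compl₁₂ F.toLinearMap F.toLinearMap with hB₁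
  set B₂ : LinearMap.BilinForm ℤ (κ × Bool → ℤ) := ε • symplForm with hB₂
  have key : B₁ = B₂ := by
    refine LinearMap.BilinForm.ext_basis (Pi.basisFun ℤ (κ × Bool)) fun x y => ?_
    simp only [hB₁, hB₂, LinearMap.compl₁₂_apply, LinearEquiv.coe_coe, LinearMap.smul_apply, Pi.basisFun_apply,
      smul_eq_mul, hF, mulVec_single_one_eq_col]
    exact hS x y
  intro u v
  have h := LinearMap.congr_fun₂ key u v
  simp only [hB₁, hB₂, LinearMap.compl₁₂_apply, LinearEquiv.coe_coe, LinearMap.smul_apply, smul_eq_mul] at h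
  exact h

/-- **Coordinate Lagrangians from a vanishing block**: if `M (i, ¬c i) (j, c j) = 0` for all `i, j`, then `v ↦ M v`
preserves the vanishing of the coordinates `(i, ¬c i)`. [folklore] -/
theorem mulVec_coord_eq_zero {n : ℕ} (c : Fin n → Bool) (M : Matrix (Fin n × Bool) (Fin n × Bool) ℤ)
    (hM : ∀ i j : Fin n, M (i, !c i) (j, c j) = 0) (v : Fin n × Bool → ℤ) (hv : ∀ i, v (i, !c i) = 0) (i : Fin n) :
    M.mulVec v (i, !c i) = 0 := by
  rw [Matrix.mulVec, dotProduct]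
  refine Finset.sum_eq_zero fun x _ => ?_
  obtain ⟨j, b⟩ := x
  by_cases hb : b = c j
  · subst hb; rw [hM, zero_mul]
  · have hb' : b = !c j := by cases b <;> cases h : c j <;> simp_all
    subst hb'; rw [hv, mul_zero]

end Matrices

/-! ## §2 Goeritz elements from matrices -/

section Goeritz

variable {m : ℕ}

/-- **A Goeritz element from an integer matrix.**  Let `M` have two-sided inverse `M'`, columns pairing as an
`ε`-isometry (`ε = ±1`), and vanishing blocks `M (i, ¬c i) (j, c j) = 0` for the cut patterns `c` of slots `0`
(`bⱼ` cut iff `j ≡ 2`) and `1` (`bⱼ` cut iff `j ≡ 1 (mod 3)`).  Then some `x ∈ Stab N₀ ∩ Stab N₁` acts on `H₁` by `M`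
and `x⁻¹` by `M'` (letterwise).  From the landed `exists_goeritz_realises` (GS₀ for coordinate pairs). [folklore] -/
theorem exists_goeritz_of_matrix (M M' : Matrix (Fin (3 + 3 * m) × Bool) (Fin (3 + 3 * m) × Bool) ℤ) (ε : ℤ)
    (hε : ε = 1 ∨ ε = -1) (h1 : M * M' = 1) (h2 : M' * M = 1)
    (hS : ∀ x y : Fin (3 + 3 * m) × Bool, symplForm (fun k => M k x) (fun k => M k y) =
      ε * symplForm (Pi.single x (1 : ℤ) : Fin (3 + 3 * m) × Bool → ℤ) (Pi.single y (1 : ℤ)))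
    (h0 : ∀ i j : Fin (3 + 3 * m), M (i, !decide ((i : ℕ) % 3 = 2)) (j, decide ((j : ℕ) % 3 = 2)) = 0)
    (h1' : ∀ i j : Fin (3 + 3 * m), M (i, !decide ((i : ℕ) % 3 = 1)) (j, decide ((j : ℕ) % 3 = 1)) = 0) :
    ∃ x : (SurfaceGroup (3 + 3 * m)) ≃* (SurfaceGroup (3 + 3 * m)),
      (s4Kernels.stabilizeIter m 0).map x.toMonoidHom = s4Kernels.stabilizeIter m 0 ∧
      (s4Kernels.stabilizeIter m 1).map x.toMonoidHom = s4Kernels.stabilizeIter m 1 ∧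
      (∀ ℓ : Fin (3 + 3 * m) × Bool, toAdd (SurfaceGroup.abelianize (3 + 3 * m) (x (PresentedGroup.of ℓ))) = fun k => M k ℓ) ∧
      ∀ ℓ : Fin (3 + 3 * m) × Bool, toAdd (SurfaceGroup.abelianize (3 + 3 * m) (x.symm (PresentedGroup.of ℓ))) = fun k => M' k ℓ := by
  obtain ⟨F, hF, hF'⟩ := exists_linearEquiv_of_matrix M M' h1 h2
  have hiso := symplForm_of_matrix F M hF ε hS
  -- the cut patterns of slots `0` and `1`
  have hc0 : (fun j : Fin (3 + 3 * m) => decide (((j : ℕ) + ((0 : Fin 3) : ℕ)) % 3 = 2)) =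
      fun j : Fin (3 + 3 * m) => decide ((j : ℕ) % 3 = 2) := by
    funext j; simp only [Fin.val_zero, add_zero]
  have hc1 : (fun j : Fin (3 + 3 * m) => decide (((j : ℕ) + ((1 : Fin 3) : ℕ)) % 3 = 2)) =
      fun j : Fin (3 + 3 * m) => decide ((j : ℕ) % 3 = 1) := by
    funext j
    simp only [Fin.val_one]
    by_cases h : (j : ℕ) % 3 = 1
    · rw [decide_eq_true h, decide_eq_true (by omega)]
    · rw [decide_eq_false h, decide_eq_false (by omega)]
  have h01 : ∀ j : Fin (3 + 3 * m), decide ((j : ℕ) % 3 = 2) = true → decide ((j : ℕ) % 3 = 1) = false := by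
    intro j
    simp only [decide_eq_true_eq, decide_eq_false_iff_not]
    omega
  have hcoord : ∀ (c : Fin (3 + 3 * m) → Bool), (∀ i j : Fin (3 + 3 * m), M (i, !c i) (j, c j) = 0) →
      ∀ v : Fin (3 + 3 * m) × Bool → ℤ, (∀ i, v (i, !c i) = 0) → ∀ i, F v (i, !c i) = 0 := by
    intro c hc v hv i
    rw [hF]
    exact mulVec_coord_eq_zero c M hc v hv i
  obtain ⟨x, hx0, hx1, hx⟩ := exists_goeritz_realises _ _ h01 F ε hε hiso (hcoord _ h0) (hcoord _ h1')
  refine ⟨x, ?_, ?_, fun ℓ => ?_, fun ℓ => ?_⟩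
  · rw [stabilizeIter_eq_cutKernel, hc0]; exact hx0
  · rw [stabilizeIter_eq_cutKernel, hc1]; exact hx1
  · rw [hx, SurfaceGroup.abelianize_of, toAdd_ofAdd, hF, mulVec_single_one_eq_col]
  · have hab_symm : toAdd (SurfaceGroup.abelianize (3 + 3 * m) (x.symm (PresentedGroup.of ℓ))) =
        F.symm (toAdd (SurfaceGroup.abelianize (3 + 3 * m) (PresentedGroup.of ℓ : (SurfaceGroup (3 + 3 * m))))) := by
      rw [eq_comm, LinearEquiv.symm_apply_eq, ← hx, MulEquiv.apply_symm_apply]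
    rw [hab_symm, SurfaceGroup.abelianize_of, toAdd_ofAdd, hF', mulVec_single_one_eq_col]

end Goeritz

/-! ## §3 Conjugated seed realisers at genus `6` and their readings -/

section ConjRealiser

/-- `s (s X) = X` for a sign `s = ±1` attached to a Boolean. [folklore] -/
theorem sign_mul_sign_mul (b : Bool) (X : ℤ) : (if b then (-1 : ℤ) else 1) * ((if b then (-1 : ℤ) else 1) * X) = X := by
  cases b <;> simp

/-- **A conjugated seed realiser and its reading** (genus `6 = 3 + 3·1`).  For a matrix `M` as in
`exists_goeritz_of_matrix` (realised by `x ∈ Stab N₀ ∩ Stab N₁`) and a handle `k`, the conjugate `y = x β x⁻¹` of the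
bounding-pair map `β = bp_{k,k+1}` lies in `Stab N₀ ∩ Stab N₁`, is IA, and for the cut pattern `ct` of slot `2` with
erasing projection `π` its corrections at the cut letters read as the pair products of the closed-form reading
`RD(M, M', k) j v w = s_j · (E(x_j, y_v, y_w) - E(x_j, y_w, y_v))`, `E` the conjugated Johnson table of
`johnson_conj_seed` for the triple `(b_k, a_k, b_{k+1})`, `s_j = -1` on `b`-cut handles. [folklore] -/
theorem exists_conj_realiser (k : Fin (3 + 3 * 1)) (M M' : Matrix (Fin (3 + 3 * 1) × Bool) (Fin (3 + 3 * 1) × Bool) ℤ)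
    (ε : ℤ) (hε : ε = 1 ∨ ε = -1) (h1 : M * M' = 1) (h2 : M' * M = 1)
    (hS : ∀ x y : Fin (3 + 3 * 1) × Bool, symplForm (fun k => M k x) (fun k => M k y) =
      ε * symplForm (Pi.single x (1 : ℤ) : Fin (3 + 3 * 1) × Bool → ℤ) (Pi.single y (1 : ℤ)))
    (h0 : ∀ i j : Fin (3 + 3 * 1), M (i, !decide ((i : ℕ) % 3 = 2)) (j, decide ((j : ℕ) % 3 = 2)) = 0)
    (h1' : ∀ i j : Fin (3 + 3 * 1), M (i, !decide ((i : ℕ) % 3 = 1)) (j, decide ((j : ℕ) % 3 = 1)) = 0)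
    {ct : Fin (3 + 3 * 1) → Bool} {π : (SurfaceGroup (3 + 3 * 1)) →* (FreeGroup (Fin (3 + 3 * 1)))} (hπs : Function.Surjective π)
    (hπof : ∀ (h : Fin (3 + 3 * 1)) (b : Bool), π (PresentedGroup.of (h, b)) = if b = ct h then 1 else FreeGroup.of h) :
    ∃ y : (SurfaceGroup (3 + 3 * 1)) ≃* (SurfaceGroup (3 + 3 * 1)),
      (s4Kernels.stabilizeIter 1 0).map y.toMonoidHom = s4Kernels.stabilizeIter 1 0 ∧
      (s4Kernels.stabilizeIter 1 1).map y.toMonoidHom = s4Kernels.stabilizeIter 1 1 ∧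
      (∀ s : (SurfaceGroup (3 + 3 * 1)), y s * s⁻¹ ∈ ((⊤ : Subgroup (SurfaceGroup (3 + 3 * 1))).lowerCentralSeries 1)) ∧
      ∀ j : Fin (3 + 3 * 1), π (y (PresentedGroup.of (j, ct j)) * (PresentedGroup.of (j, ct j))⁻¹) *
        (((List.finRange (3 + 3 * 1)).map (fun v => ((List.finRange (3 + 3 * 1)).map (fun w => if v < w then ⁅(FreeGroup.of v : FreeGroup (Fin (3 + 3 * 1))), FreeGroup.of w⁆ ^ ( (if ct j then (-1 : ℤ) else 1) * ((if ct j then (-1 : ℤ) else 1) * (((∑ x : Fin (3 + 3 * 1) × Bool, M' x (j, ct j) * (if x.1 = ((k : Fin (3 + 3 * 1)), true).1 ∧ x.2 = false ∧ ((k : Fin (3 + 3 * 1)), true).2 = true then (1 : ℤ) else if x.1 = ((k : Fin (3 + 3 * 1)), true).1 ∧ x.2 = true ∧ ((k : Fin (3 + 3 * 1)), true).2 = false then (-1 : ℤ) else 0)) * (M (v, !ct v) ((k : Fin (3 + 3 * 1)), false) * M (w, !ct w) ((k : Fin (3 + 3 * 1)) + 1, true)) + (∑ x : Fin (3 + 3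 * 1) × Bool, M' x (j, ct j) * (if x.1 = ((k : Fin (3 + 3 * 1)), false).1 ∧ x.2 = false ∧ ((k : Fin (3 + 3 * 1)), false).2 = true then (1 : ℤ) else if x.1 = ((k : Fin (3 + 3 * 1)), false).1 ∧ x.2 = true ∧ ((k : Fin (3 + 3 * 1)), false).2 = false then (-1 : ℤ) else 0)) * (M (v, !ct v) ((k : Fin (3 + 3 * 1)) + 1, true) * M (w, !ct w) ((k : Fin (3 + 3 * 1)), true)) + (∑ x : Fin (3 + 3 * 1) × Bool, M' x (j, ct j) * (if x.1 = ((k : Fin (3 + 3 * 1)) + 1, true).1 ∧ x.2 = false ∧ ((k : Fin (3 + 3 * 1)) + 1, true).2 = true then (1 : ℤ) else if x.1 = ((k : Fin (3 + 3 * 1)) + 1, true).1 ∧ x.2 = true ∧ ((k : Fin (3 + 3 * 1)) + 1, true).2 = false then (-1 : ℤ) else 0)) * (M (v, !ct v) ((k : Fin (3 + 3 * 1)), true) * M (w, !ct w) ((k : Fin (3 + 3 * 1)), false))) - ((∑ x : Fin (3 + 3 * 1) × Bool, M' x (j, ct j) * (if x.1 = ((k : Fin (3 + 3 * 1)), true).1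 ∧ x.2 = false ∧ ((k : Fin (3 + 3 * 1)), true).2 = true then (1 : ℤ) else if x.1 = ((k : Fin (3 + 3 * 1)), true).1 ∧ x.2 = true ∧ ((k : Fin (3 + 3 * 1)), true).2 = false then (-1 : ℤ) else 0)) * (M (w, !ct w) ((k : Fin (3 + 3 * 1)), false) * M (v, !ct v) ((k : Fin (3 + 3 * 1)) + 1, true)) + (∑ x : Fin (3 + 3 * 1) × Bool, M' x (j, ct j) * (if x.1 = ((k : Fin (3 + 3 * 1)), false).1 ∧ x.2 = false ∧ ((k : Fin (3 + 3 * 1)), false).2 = true then (1 : ℤ) else if x.1 = ((k : Fin (3 + 3 * 1)), false).1 ∧ x.2 = true ∧ ((k : Fin (3 + 3 * 1)), false).2 = false then (-1 : ℤ) else 0)) * (M (w, !ct w) ((k : Fin (3 + 3 * 1)) + 1, true) * M (v, !ct v) ((k : Fin (3 + 3 * 1)), true)) + (∑ x : Fin (3 + 3 * 1) × Bool, M' x (j, ct j) * (if x.1 = ((k : Fin (3 + 3 * 1)) + 1, true).1 ∧ x.2 = false ∧ ((k : Fin (3 + 3 * 1)) + 1, true).2 = true then (1 : ℤ) else if x.1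 = ((k : Fin (3 + 3 * 1)) + 1, true).1 ∧ x.2 = true ∧ ((k : Fin (3 + 3 * 1)) + 1, true).2 = false then (-1 : ℤ) else 0)) * (M (w, !ct w) ((k : Fin (3 + 3 * 1)), true) * M (v, !ct v) ((k : Fin (3 + 3 * 1)), false))))) ) else (1 : FreeGroup (Fin (3 + 3 * 1))))).prod)).prod)⁻¹ ∈ ((⊤ : Subgroup (FreeGroup (Fin (3 + 3 * 1)))).lowerCentralSeries 2) := by
  obtain ⟨x, hx0, hx1, hM, hM'⟩ := exists_goeritz_of_matrix (m := 1) M M' ε hε h1 h2 hS h0 h1'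
  obtain ⟨β, hβIA, hβτ, hβcut⟩ := exists_bp_handle 3 k
  have hβ0 : (s4Kernels.stabilizeIter 1 0).map β.toMonoidHom = s4Kernels.stabilizeIter 1 0 := by
    rw [stabilizeIter_eq_cutKernel]; exact hβcut _
  have hβ1 : (s4Kernels.stabilizeIter 1 1).map β.toMonoidHom = s4Kernels.stabilizeIter 1 1 := by
    rw [stabilizeIter_eq_cutKernel]; exact hβcut _
  obtain ⟨cS, hcS⟩ : ∃ cS : Fin (3 + 3 * 1) × Bool → Fin (3 + 3 * 1) × Bool → (Subgroup.center (SurfaceGroup (3 + 3 * 1) ⧸ (⊤ : Subgroup (SurfaceGroup (3 + 3 * 1))).lowerCentralSeries 2)),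
      ∀ p q, (cS p q : (SurfaceGroup (3 + 3 * 1) ⧸ (⊤ : Subgroup (SurfaceGroup (3 + 3 * 1))).lowerCentralSeries 2)) = ⁅((PresentedGroup.of p : (SurfaceGroup (3 + 3 * 1))) : (SurfaceGroup (3 + 3 * 1) ⧸ (⊤ : Subgroup (SurfaceGroup (3 + 3 * 1))).lowerCentralSeries 2)), ((PresentedGroup.of q : (SurfaceGroup (3 + 3 * 1))) : (SurfaceGroup (3 + 3 * 1) ⧸ (⊤ : Subgroup (SurfaceGroup (3 + 3 * 1))).lowerCentralSeries 2))⁆ :=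
    ⟨fun p q => ⟨_, c2_mem_center quot_class_two _ _⟩, fun p q => rfl⟩
  refine ⟨x.symm.trans (β.trans x), map_conj_of_map_eq x β hx0 hβ0, map_conj_of_map_eq x β hx1 hβ1, ia_conj hβIA x,
    fun j => ?_⟩
  have hE := johnson_conj_seed (k, true) (k, false) (k + 1, true) β x hβIA hβτ M M' hM hM' cS hcS
  have hread := reading_of_table ct π hπs hπof (x.symm.trans (β.trans x)) cS hcS _ hE j
  have key : (((List.finRange (3 + 3 * 1)).map (fun v => ((List.finRange (3 + 3 * 1)).map (fun w => if v < w then ⁅(FreeGroup.of v : FreeGroup (Fin (3 + 3 * 1))), FreeGroup.of w⁆ ^ ( (if ct j then (-1 : ℤ) else 1) * ((if ct j then (-1 : ℤ) else 1) * (((∑ x : Fin (3 + 3 * 1) × Bool, M' x (j, ct j) * (if x.1 = ((k : Fin (3 + 3 * 1)), true).1 ∧ x.2 = false ∧ ((k : Fin (3 + 3 * 1)), true).2 = true then (1 : ℤ) else if x.1 = ((k : Fin (3 + 3 * 1)), true).1 ∧ x.2 = true ∧ ((k : Fin (3 + 3 * 1)), true).2 = false then (-1 : ℤ) else 0)) *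 (M (v, !ct v) ((k : Fin (3 + 3 * 1)), false) * M (w, !ct w) ((k : Fin (3 + 3 * 1)) + 1, true)) + (∑ x : Fin (3 + 3 * 1) × Bool, M' x (j, ct j) * (if x.1 = ((k : Fin (3 + 3 * 1)), false).1 ∧ x.2 = false ∧ ((k : Fin (3 + 3 * 1)), false).2 = true then (1 : ℤ) else if x.1 = ((k : Fin (3 + 3 * 1)), false).1 ∧ x.2 = true ∧ ((k : Fin (3 + 3 * 1)), false).2 = false then (-1 : ℤ) else 0)) * (M (v, !ct v) ((k : Fin (3 + 3 * 1)) + 1, true) * M (w, !ct w) ((k : Fin (3 + 3 * 1)), true)) + (∑ x : Fin (3 + 3 * 1) × Bool, M' x (j, ct j) * (if x.1 = ((k : Fin (3 + 3 * 1)) + 1, true).1 ∧ x.2 = false ∧ ((k : Fin (3 + 3 * 1)) + 1, true).2 = true then (1 : ℤ) else if x.1 = ((k : Fin (3 + 3 * 1)) + 1, true).1 ∧ x.2 = true ∧ ((k : Fin (3 + 3 * 1)) + 1, true).2 = false then (-1 : ℤ) else 0)) * (M (v, !ct v) ((k : Fin (3 + 3 * 1)), true) * M (w, !ct w) ((k :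 Fin (3 + 3 * 1)), false))) - ((∑ x : Fin (3 + 3 * 1) × Bool, M' x (j, ct j) * (if x.1 = ((k : Fin (3 + 3 * 1)), true).1 ∧ x.2 = false ∧ ((k : Fin (3 + 3 * 1)), true).2 = true then (1 : ℤ) else if x.1 = ((k : Fin (3 + 3 * 1)), true).1 ∧ x.2 = true ∧ ((k : Fin (3 + 3 * 1)), true).2 = false then (-1 : ℤ) else 0)) * (M (w, !ct w) ((k : Fin (3 + 3 * 1)), false) * M (v, !ct v) ((k : Fin (3 + 3 * 1)) + 1, true)) + (∑ x : Fin (3 + 3 * 1) × Bool, M' x (j, ct j) * (if x.1 = ((k : Fin (3 + 3 * 1)), false).1 ∧ x.2 = false ∧ ((k : Fin (3 + 3 * 1)), false).2 = true then (1 : ℤ) else if x.1 = ((k : Fin (3 + 3 * 1)), false).1 ∧ x.2 = true ∧ ((k : Fin (3 + 3 * 1)), false).2 = false then (-1 : ℤ) else 0)) * (M (w, !ct w) ((k : Fin (3 + 3 * 1)) + 1, true) * M (v, !ct v) ((k : Fin (3 + 3 * 1)), true)) + (∑ x : Fin (3 + 3 * 1) × Bool, M' x (j, ct j) * (if x.1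 = ((k : Fin (3 + 3 * 1)) + 1, true).1 ∧ x.2 = false ∧ ((k : Fin (3 + 3 * 1)) + 1, true).2 = true then (1 : ℤ) else if x.1 = ((k : Fin (3 + 3 * 1)) + 1, true).1 ∧ x.2 = true ∧ ((k : Fin (3 + 3 * 1)) + 1, true).2 = false then (-1 : ℤ) else 0)) * (M (w, !ct w) ((k : Fin (3 + 3 * 1)), true) * M (v, !ct v) ((k : Fin (3 + 3 * 1)), false))))) ) else (1 : FreeGroup (Fin (3 + 3 * 1))))).prod)).prod) = (((List.finRange (3 + 3 * 1)).map (fun v => ((List.finRange (3 + 3 * 1)).map (fun w => if v < w then ⁅(FreeGroup.of v : FreeGroup (Fin (3 + 3 * 1))), FreeGroup.of w⁆ ^ ( (((∑ x : Fin (3 + 3 * 1) × Bool, M' x (j, ct j) * (if x.1 = ((k : Fin (3 + 3 * 1)), true).1 ∧ x.2 = false ∧ ((k : Fin (3 + 3 * 1)), true).2 = true then (1 : ℤ) else if x.1 = ((k : Fin (3 + 3 * 1)), true).1 ∧ x.2 = true ∧ ((k : Fin (3 + 3 * 1)), true).2 = false then (-1 : ℤ) else 0)) * (M (v, !ct v)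 ((k : Fin (3 + 3 * 1)), false) * M (w, !ct w) ((k : Fin (3 + 3 * 1)) + 1, true)) + (∑ x : Fin (3 + 3 * 1) × Bool, M' x (j, ct j) * (if x.1 = ((k : Fin (3 + 3 * 1)), false).1 ∧ x.2 = false ∧ ((k : Fin (3 + 3 * 1)), false).2 = true then (1 : ℤ) else if x.1 = ((k : Fin (3 + 3 * 1)), false).1 ∧ x.2 = true ∧ ((k : Fin (3 + 3 * 1)), false).2 = false then (-1 : ℤ) else 0)) * (M (v, !ct v) ((k : Fin (3 + 3 * 1)) + 1, true) * M (w, !ct w) ((k : Fin (3 + 3 * 1)), true)) + (∑ x : Fin (3 + 3 * 1) × Bool, M' x (j, ct j) * (if x.1 = ((k : Fin (3 + 3 * 1)) + 1, true).1 ∧ x.2 = false ∧ ((k : Fin (3 + 3 * 1)) + 1, true).2 = true then (1 : ℤ) else if x.1 = ((k : Fin (3 + 3 * 1)) + 1, true).1 ∧ x.2 = true ∧ ((k : Fin (3 + 3 * 1)) + 1, true).2 = false then (-1 : ℤ) else 0)) * (M (v, !ct v) ((k : Fin (3 + 3 * 1)), true) * M (w, !ct w) ((k : Fin (3 + 3 *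 1)), false))) - ((∑ x : Fin (3 + 3 * 1) × Bool, M' x (j, ct j) * (if x.1 = ((k : Fin (3 + 3 * 1)), true).1 ∧ x.2 = false ∧ ((k : Fin (3 + 3 * 1)), true).2 = true then (1 : ℤ) else if x.1 = ((k : Fin (3 + 3 * 1)), true).1 ∧ x.2 = true ∧ ((k : Fin (3 + 3 * 1)), true).2 = false then (-1 : ℤ) else 0)) * (M (w, !ct w) ((k : Fin (3 + 3 * 1)), false) * M (v, !ct v) ((k : Fin (3 + 3 * 1)) + 1, true)) + (∑ x : Fin (3 + 3 * 1) × Bool, M' x (j, ct j) * (if x.1 = ((k : Fin (3 + 3 * 1)), false).1 ∧ x.2 = false ∧ ((k : Fin (3 + 3 * 1)), false).2 = true then (1 : ℤ) else if x.1 = ((k : Fin (3 + 3 * 1)), false).1 ∧ x.2 = true ∧ ((k : Fin (3 + 3 * 1)), false).2 = false then (-1 : ℤ) else 0)) * (M (w, !ct w) ((k : Fin (3 + 3 * 1)) + 1, true) * M (v, !ct v) ((k : Fin (3 + 3 * 1)), true)) + (∑ x : Fin (3 + 3 * 1) × Bool, M' x (j, ct j) * (if x.1 = ((k : Fin (3 +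 3 * 1)) + 1, true).1 ∧ x.2 = false ∧ ((k : Fin (3 + 3 * 1)) + 1, true).2 = true then (1 : ℤ) else if x.1 = ((k : Fin (3 + 3 * 1)) + 1, true).1 ∧ x.2 = true ∧ ((k : Fin (3 + 3 * 1)) + 1, true).2 = false then (-1 : ℤ) else 0)) * (M (w, !ct w) ((k : Fin (3 + 3 * 1)), true) * M (v, !ct v) ((k : Fin (3 + 3 * 1)), false)))) ) else (1 : FreeGroup (Fin (3 + 3 * 1))))).prod)).prod) :=
    pp_congr _ _ _ _ fun v w _ => by
      congr 1
      exact sign_mul_sign_mul (ct j) _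
  rw [key]
  exact hread

end ConjRealiser

/-! ## Registered helper -/

/-- **Registered helper `helper_goeritzOfMatrix`** (sub-goal of stub `stub_layerStepOneZero`, crux stmt-SmoothPoincare4-14595):
a Goeritz element of the standard genus-`(3+3m)` splitting from an integer matrix passing the decidable checks, in closed form.
[folklore] -/
theorem helper_goeritzOfMatrix : ∀ (m : ℕ) (M M' : Matrix (Fin (3 + 3 * m) × Bool) (Fin (3 + 3 * m) × Bool) ℤ) (ε : ℤ), (ε = 1 ∨ ε = -1) → M * M' = 1 → M' * M = 1 → (∀ x y : Fin (3 + 3 * m) × Bool, symplForm (fun k => M k x) (fun k => M k y) = ε * symplForm (Pi.single x (1 : ℤ) : Fin (3 + 3 * m) × Bool → ℤ) (Pi.single y (1 : ℤ))) → (∀ i j : Fin (3 + 3 * m), M (i, !decide ((i : ℕ) % 3 = 2)) (j, decide ((j : ℕ) % 3 = 2)) = 0) → (∀ i j : Fin (3 + 3 * m), M (i, !decide ((i : ℕ) % 3 = 1)) (j, decide ((j : ℕ) % 3 = 1)) = 0) → ∃ x : SurfaceGroup (3 + 3 * m) ≃* SurfaceGroup (3 + 3 * m), (s4Kernels.stabilizeIter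 m 0).map x.toMonoidHom = s4Kernels.stabilizeIter m 0 ∧ (s4Kernels.stabilizeIter m 1).map x.toMonoidHom = s4Kernels.stabilizeIter m 1 ∧ (∀ ℓ : Fin (3 + 3 * m) × Bool, toAdd (SurfaceGroup.abelianize (3 + 3 * m) (x (PresentedGroup.of ℓ))) = fun k => M k ℓ) ∧ ∀ ℓ : Fin (3 + 3 * m) × Bool, toAdd (SurfaceGroup.abelianize (3 + 3 * m) (x.symm (PresentedGroup.of ℓ))) = fun k => M' k ℓ :=
  fun _ M M' ε hε h1 h2 hS h0 h1' => exists_goeritz_of_matrix M M' ε hε h1 h2 hS h0 h1'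

end Summit.SmoothPoincare4.SmoothPoincare4.Theorems.ShadowApproximation.NilpotentGenusClass

end
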